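import Summits.QuantumFields.YangMills.Theorems.BalabanUVNodesN07SplitClauseHeadKnitMeetNormalisedTowerWStep
import Summits.QuantumFields.YangMills.Theorems.BalabanUVNodesN07ChartMeetNorm77OfLetters
import Summits.QuantumFields.YangMills.Theorems.BalabanUVNodesN07Thm4RecordStructure
import HarnessLib

/-!
# N07 [B11] (= [15] = [Balaban1985Variational]) Sect. F, S6 HEAD — **THE GUARDED [15] PROP. 8 STEP TOKEN OF RECORD, END TO END: FROM THE ONE NAMED PREMISE `HThm4Rec` AND THE TWO
# CHART LETTERS (c′) ∕ (d′), WITH ONE CLOSED-FORM BUDGET ROW** — MODULE 83 = MODULE 77c ∘ MODULE 82b ∘ n07-w3's S1ᶜ door `hS3NORM67c_of_hThm4Rec`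

Cell `pub-ymgap`, seat `pub-ymgap-dag-n07-e` g27 (FAN-OUT §N07 row s3; LANE OWNER of the K0 road), MODULE 83 (INTENT-83, cell bus).
`--kind proof --supports stmt-QuantumFields-20541 --as helper` (K0⁷); count-neutral; def-free.  [15] = [Balaban1985Variational]; [6] = [Balaban1985RegularSpaces]; [I] = [Balaban1987RG1];
[4] = [Balaban1984PropagatorsII].

WHY THIS FILE.  After MODULES 77a∕b∕c, 78–81, 82a∕b (this lane, 2026-08-29) and n07-w3 g8's `…N07Thm4RecordStructure` the head of the K0 road reads, BY NAME, «77b ∘ 82b ∘ 77c =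
HS3NORM-67c + (c′) + (d′) + HLETTERS∕HBUDGET-NORM + chain letters → `Prop8RegSepTopStepG`» (referee READ-494), and HS3NORM-67c at `Nrm := NrmOfRecordWide` has the CONDITIONAL door S1ᶜ from
the named premise `HThm4Rec` (plan g90 RULING A3).  This file performs the three compositions IN KERNEL, once, so that the guarded [15] Prop. 8 step token at the record displays EXACTLY:
the structural letters and the guard of 77c, the token's smallness letters, `hT : HThm4Rec F N Mc ρ κ a₀` (N05-REC's target), the two chart letters (c′) `hQnear` ∕ (d′) `hA1` (82b's binder
texts VERBATIM — the targets of the two summoned pens), the sign `0 ≤ β₁`, and ONE closed-form budget row in the two remaining size letters `β₁`, `t₁` (the K0 assembler's arithmetic).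
It also confirms by name that n07-w3's door, typed against MODULE 67c, applies to MODULE 77c's HS3NORM-67c hypothesis byte for byte.

WHAT IS PROVED (sorry-free; no definition; axioms standard).
* §1 `exists_thresholds_of_budget_lt` — pure real arithmetic: a strict closed-form row `t₁ + X < R` yields 77c's two thresholds `X < t₂`, `0 < t₃`, `t₁ + t₂ + t₃ < R`.
* §2 ★★★ `prop8RegSepTopStepG_of_hThm4Rec_of_letters F N` — `Prop8RegSepTopStepG F N suppDom Adm B₃ a₀ a₁` for EVERY guard `Adm` implying the V20-G conjuncts and the run's grid numerics,
  from: 77c's structural letters (`Mc`, `M_h = L^{a′} ≥ M_h⁰`, `R ≥ R₀`, the collar `ρ` with `L·M_h ∣ ρ`, `R·L·M_h ≤ ρ`, `Mc ≤ ρ`, `L ≤ ρ`), the guard constants `c`, `c₀` with their side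
  conditions, the token letters `B₃ C θ Q κ a₀ a₁` with `0 < κ`, `2L² ≤ B₃`, `4C ≤ B₃`, `16θ ≤ 1`, `(16Q + 1024κ²)a₀ ≤ 1`, `32κa₀ ≤ 1`; the chart letters `β₁ t₁ : (ℕ → ℝ) → (ℕ → ℝ) → ℕ → ℝ`
  with `0 ≤ β₁` in the token's range; ONE budget row (ranged) `t₁ ε δ j + ¼·sideP·max (4C_H B_H·β₁ ε δ j) (8C_H B_H e^{−δ_H ρ}·(κ·L·ε_j)) < C δ_j + θ ε_j + Q ε_j²` — 77c's HBUDGET-NORM at the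
  letters of record `β₂ := κ·L·ε_j` (MODULE 78∕82b), `s′ := 0` (82a's `B′ := 0`), `θ_H := 8C_H B_H e^{−δ_H ρ}` (77c's floor, the optimal choice); the ONE CONDITIONAL PREMISE `HThm4Rec F N Mc ρ κ a₀`;
  and the two chart letters (c′) `hQnear` (near rows of the block averages `Q A` on MODULE 77's near class) and (d′) `hA1` (the (158) letters of `A − H_V(𝟙_reach·QA)`), both 82b's texts.
  Proof: 77c `prop8RegSepTopStepG_of_normalisedGauge_of_chartMeetTowerW` at `Nrm := NrmOfRecordWide F N Mc ρ`, its HS3NORM-67c hypothesis := n07-w3 `hS3NORM67c_of_hThm4Rec`, its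
  HCHART-MEET-NORM-77 hypothesis := 82b `chartMeetNorm77_of_letters`, HLETTERS∕HBUDGET-NORM := §1 on the closed-form row.
NET OBLIGATION OF THE K0 ROAD's HEAD AFTER THIS FILE (by name, nothing else displayed): `HThm4Rec` (N05-REC lane; premise of record `HThm4RecEx` binds `κ`, `a₀`, `ρ`), (c′) (n07-w6 pen),
(d′) (k0-s1 pen), the budget row (K0 assembler, once the pens' `β₁`, `t₁` shapes are of record), the guard's grid-numerics implication (V21-G candidate, plan) and the smallness letters.
HONEST SCOPE: count-neutral by-name composition + three lines of real arithmetic; every named hypothesis displayed, NOT discharged; `HThm4Rec` is CONDITIONAL (print-licensed [I] pp. 253–254,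
not print-proved for the (0.4) structure); NO stub registered or closed; nothing of [15]∕[6] ANALYSIS asserted; K0⁷ ∕ K1⁹ NOT closed; N07 NOT discharged and NOT claimable on road (β) while
`HThm4Rec` is undischarged; counts unmoved (typed 28∕28 · discharged 8∕27 per the chair); one finite 𝕋⁴ programme at fixed ε — the route closes the conditional finite-𝕋⁴ rung
`BalabanLadder.UV` ONLY; the YM mass gap (Clay) is NOT proved by any of this; nothing continuum ∕ ℝ⁴ ∕ OS.  No `sorry` ∕ `def` ∕ `instance` ∕ `notation`.

References: [15] (144) p. 300, (147)–(153) p. 301, (154)–(159) pp. 302–303, (160)–(168) pp. 303–304, Prop. 8 p. 304; [6] Thm. 2 p. 83, Thm. 4 p. 88, Prop. 6 (1.130)–(1.138) pp. 98–99,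
(1.29) p. 81, (1.131) p. 99; [4] (2.1)–(2.4) p. 224, (2.35) p. 228; [I] (0.1) p. 251, (0.4) p. 253.
-/

set_option autoImplicit false

noncomputable section
open scoped BigOperators Matrix.Norms.L2Operator

namespace Summit.QuantumFields.YangMills.BalabanUVNodes.N07Prop8StepTokenOfRecordOfLetters

open Literature.MathematicalPhysics.QuantumFieldTheory.Balaban1983to89
open Literature.MathematicalPhysics.QuantumFieldTheory.Balaban1983to89.Node00
open Literature.MathematicalPhysics.QuantumFieldTheory.Balaban1983to89.B15DeterminingSets
open Literature.MathematicalPhysics.QuantumFieldTheory.Balaban1983to89.B12RegularSpaces111 (gaugeU expI grad)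
open LatticeFieldCalculus (bondAvgIter)
open B15Eq112TorusCover (cover)
open B14DomainGeom (Pt Within)
open B5Eq117TorusCarriers (Mk)
open B5Eq118OneStroke (iterBlockOf)
open B5Prop12FieldsLattice (distSite)
open B8Eq131Cubes (sqLo sqHi box cube)
open B11Eq115Space (levOf)
open B6SectADomainsV1 (Domains)
open B6SectAOperatorsV1 (BondIdx RE dsE QpE)
open Literature.MathematicalPhysics.QuantumFieldTheory.BalabanImbrieJaffe1984to88.BIJ85AxialPropagator411 (BondSpace)
open T4Continuum (T4Family)
open T4AxialGaugeSmallField (castSite)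
open GaugeField (gaugeAct)
open Summit.QuantumFields.YangMills.Theorems.K0FlatCubeOpsTextP (flatH)
open Summit.QuantumFields.YangMills.BalabanUVNodes.N07HalvingStepTopOfLocalLetters (Letters10On)
open Summit.QuantumFields.YangMills.BalabanUVNodes.N07NormalisationOfRecordWide (NrmOfRecordWide)
open Summit.QuantumFields.YangMills.BalabanUVNodes.N07Thm4RecordStructure (HThm4Rec hS3NORM67c_of_hThm4Rec)
open Summit.QuantumFields.YangMills.BalabanUVNodes.N07ChartMeetNorm77OfLetters (chartMeetNorm77_of_letters)
open Summit.QuantumFields.YangMills.BalabanUVNodes.N07SplitClauseHeadKnitMeetNormalisedTowerWStep (prop8RegSepTopStepG_of_normalisedGauge_of_chartMeetTowerW)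

/-! ## §1  The budget's two thresholds from one closed-form strict row -/

/-- The closed-form budget row `t₁ + X < R` produces MODULE 77c's two thresholds: `t₂ := X + (R − t₁ − X)∕3` above the data floor `X`, `t₃ := (R − t₁ − X)∕3 > 0` above the
(vanishing) small-datum floor, with `t₁ + t₂ + t₃ < R`.  Pure arithmetic. [cite: Balaban1985Variational, (162)–(166) pp.303–304] -/
theorem exists_thresholds_of_budget_lt {t₁ X R : ℝ} (h : t₁ + X < R) :
    ∃ t₂ t₃ : ℝ, X < t₂ ∧ (0 : ℝ) < t₃ ∧ t₁ + t₂ + t₃ < R :=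
  ⟨X + (R - (t₁ + X)) / 3, (R - (t₁ + X)) / 3, by linarith, by linarith, by linarith⟩

/-! ## §2  The guarded [15] Prop. 8 step token of record from `HThm4Rec`, (c′), (d′) and the closed-form budget row -/

open scoped Classical in
/-- ★★★ **THE GUARDED [15] PROP. 8 STEP TOKEN OF RECORD, END TO END** — MODULE 77c's `prop8RegSepTopStepG_of_normalisedGauge_of_chartMeetTowerW` at the normalisation text of record
`Nrm := NrmOfRecordWide F N Mc ρ`, with its HS3NORM-67c hypothesis DISCHARGED by n07-w3's conditional door `hS3NORM67c_of_hThm4Rec` from the ONE named premise `hT : HThm4Rec F N Mc ρ κ a₀`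
([6] Thm. 4 ∕ Prop. 6 with [15] (152)–(153) and «ū = 1 on Λ′» for the record structure — CONDITIONAL, N05-REC's target), its HCHART-MEET-NORM-77 hypothesis DISCHARGED by MODULE 82b's
`chartMeetNorm77_of_letters` from the two displayed chart letters (c′) `hQnear` (near rows of the block averages `QA`, print (156)∕(160)) and (d′) `hA1` (the (158) letters of
`A − H_V(𝟙_reach·QA)`), and its HLETTERS∕HBUDGET-NORM hypotheses read at the letters of record `β₂ := κ·L·ε_j`, `s′ := 0`, `θ_H := 8C_H B_H e^{−δ_H ρ}` as the sign `0 ≤ β₁` and ONE closed-form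
strict budget row in `β₁`, `t₁`.  Every other binder is 77c's, byte for byte; `κ` is now POSITIVE (the door's guard).  Conclusion: `Prop8RegSepTopStepG F N suppDom Adm B₃ a₀ a₁` for EVERY guard
`Adm` implying the V20-G conjuncts and the run's grid numerics.  Nothing registered or closed; `HThm4Rec`, (c′), (d′), the budget row displayed, discharged by nobody.
[cite: Balaban1985Variational, Prop. 8 p.304, (144) p.300, (147)–(153) p.301, (154)–(159) pp.302–303, (160)–(168) pp.303–304; Balaban1985RegularSpaces, Thm. 4 p.88, Prop. 6 (1.130)–(1.138) pp.98–99, (1.29) p.81, (1.131) p.99; Balaban1984PropagatorsII, (2.1)–(2.4) p.224, (2.35) p.228; Balaban1987RG1, (0.1) p.251, (0.4) p.253] -/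
theorem prop8RegSepTopStepG_of_hThm4Rec_of_letters (F : T4Family) (N : ℕ) [NeZero N] :
    ∃ (Mh₀ R₀ : ℕ) (CH δH BH : ℝ), 0 ≤ CH ∧ 0 < δH ∧ 0 < BH ∧
    ∀ {ρ : ℕ}
      -- structural letters (77c): grid cube `Mc`, block height `a′` (`M_h = L^{a′} ≥ M_h⁰`), `R ≥ R₀`, the collar `ρ` with `L·M_h ∣ ρ`, `R·L·M_h ≤ ρ`, `L ≤ ρ`
      {Mc Mh R a' : ℕ} (_ : 1 ≤ Mc) (_ : Mc ≤ ρ) (_ : Mh = F.L ^ a') (_ : Mh₀ ≤ Mh) (_ : R₀ ≤ R) (_ : F.L * Mh ∣ ρ) (_ : R * (F.L * Mh) ≤ ρ) (hLρ : F.L ≤ ρ)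
      -- the two constants of the plan's V20-G guard `c ≤ ν.M₁ ∧ k + c₀ ≤ F.m + K` and their side conditions (77c ∕ FILE D)
      {c c₀ : ℕ} (_ : (11 * 4 + 4 * ρ + Mc + 3) * F.L ≤ c) (_ : Mc + 11 * 4 + 6 * ρ ≤ 2 * F.L ^ c₀) (_ : F.m ≤ c₀) (_ : a' + 3 ≤ c₀)
      -- ★ THE GUARD: any step guard implying the V20-G conjuncts AND the run's grid numerics the meet's (2.1) needs (`hgran`, `hdiv`)
      (Adm : StepGuard F) (_ : ∀ (ν : Stage7Numerics) (M : ℕ) (g : ℕ → ℝ) (K k : ℕ) (s : SeqOfRecord F ν M g K k), Adm ν M g K k s → c ≤ ν.M₁ ∧ k + c₀ ≤ F.m + K)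
      (_ : ∀ (ν : Stage7Numerics) (M : ℕ) (g : ℕ → ℝ) (K k : ℕ) (s : SeqOfRecord F ν M g K k), Adm ν M g K k s → ∀ j : ℕ, 1 ≤ j → j ≤ k →
        F.L * Mh ∣ M * RkOfRecord (F.P K).L ν.r (g j) ∧ dCubeSide (F.P K).L M (RkOfRecord (F.P K).L ν.r (g j)) j ∣ (F.P K).sitesPerDir 0)
      -- the token's letters, `0 < B₃`, the (152)-letter `κ`, NOW POSITIVE (the door's guard)
      {B₃ C θ Q κ a₀ a₁ : ℝ} (_ : 0 < B₃) (_ : 0 ≤ C) (_ : 0 ≤ θ) (_ : 0 ≤ Q) (_ : 0 < κ)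
      -- V19's floor `2L² ≤ B₃` and the (162)–(166♭) smallness letters of the closers
      (_ : 2 * (F.L : ℝ) ^ 2 ≤ B₃) (_ : 4 * C ≤ B₃) (_ : 16 * θ ≤ 1) (_ : (16 * Q + 1024 * κ ^ 2) * a₀ ≤ 1) (_ : 32 * κ * a₀ ≤ 1)
      -- the chart side's TWO remaining PER-LEVEL SIZE LETTERS: (c′)'s near-row letter `β₁`, (d′)'s (158) letter `t₁`
      (β₁ t₁ : (ℕ → ℝ) → (ℕ → ℝ) → ℕ → ℝ)
      -- ★ HLETTERS of record (RANGED): the sign of `β₁` only (`β₂ = κ·L·ε_j ≥ 0` and `s′ = 0` are automatic)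
      (_ : ∀ (ε δ : ℕ → ℝ) (j : ℕ), 0 < δ j → δ j ≤ a₁ → B₃ * δ j ≤ ε j → ε j ≤ a₀ → 0 ≤ β₁ ε δ j)
      -- ★ HBUDGET of record (RANGED, CLOSED FORM): 77c's HBUDGET-NORM at `β₂ := κ·L·ε_j`, `s′ := 0`, `θ_H := 8C_H B_H e^{−δ_H ρ}`
      (_ : ∀ (K : ℕ) (ε δ : ℕ → ℝ) (j : ℕ), 0 < δ j → δ j ≤ a₁ → B₃ * δ j ≤ ε j → ε j ≤ a₀ →
        t₁ ε δ j + 1 / 4 * ((sideP (F.P K) Mc ρ : ℕ) : ℝ) *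
            max (4 * CH * BH * β₁ ε δ j) (8 * CH * BH * Real.exp (-(δH * (ρ : ℝ))) * (κ * (F.L : ℝ) * ε j)) <
          C * δ j + θ * ε j + Q * ε j ^ 2)
      -- ★ THE ONE CONDITIONAL PREMISE OF RECORD (plan g90 RULING A3): n07-w3's `HThm4Rec` — [6] Thm. 4 ∕ Prop. 6 with (152)–(153) and «ū = 1 on Λ′» for the record structure
      (hT : HThm4Rec F N Mc ρ κ a₀)
      -- ★ (c′) THE NEAR ROWS OF THE BLOCK AVERAGES `QA` on MODULE 77's near class — displayed, NOT discharged (MODULE 80's data rows + print's (156) linearisation; n07-w6 lineage) — 82b's text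
      (hQnear :
        ∀ (ν : Stage7Numerics) (M : ℕ) (g : ℕ → ℝ) (K k : ℕ) (s : SeqOfRecord F ν M g K k), Sect2.SeqSeparated ν.M₁ s → 0 < ν.M₁ →
          Adm ν M g K k s → 1 ≤ k →
          ∀ (ε δ : ℕ → ℝ),
          (∀ n, n ≤ k → 0 < δ n ∧ δ n ≤ a₁) → (∀ n, n < k → δ n ≤ 2 * δ (n + 1)) → (∀ n, n < k → δ (n + 1) ≤ 2 * δ n) →
          (∀ n, n ≤ k → B₃ * δ n ≤ ε n ∧ ε n ≤ a₀) → (∀ n, n < k → ε n ≤ 2 * ε (n + 1)) → (∀ n, n < k → ε (n + 1) ≤ 2 * ε n) →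
          ∀ W : MSField (F.P K) (SU N), Sect2.DataSmall7PTop (avOfRecord F N K) s.Ω (suppDomOfRecord F ν K s.Ω) k δ W →
          ∀ U : GaugeField (F.P K) 0 (SU N),
          (∀ n, n ≤ k → PlaqSmallOn (Sect2.omegaPlaqsTop s.Ω (suppDomOfRecord F ν K s.Ω) n) (ε n * (F.P K).eta n ^ 2) U) →
          (∀ n, n ≤ k → Sect2.CoDivSmallOn (Sect2.omegaBondsTop s.Ω (suppDomOfRecord F ν K s.Ω) n) (ε n * (F.P K).eta n ^ 3) U) →
          AgreeOn (genSet s.Ω k) (avgFamily (avOfRecord F N K) U) W → IsCritOnFibre F N K (genSet s.Ω k) W U →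
          ∀ (n : ℕ) (hk : K - n ≤ (F.P K).m + (F.P K).K), 1 ≤ K - n → K - n ≤ k → ∀ (idx : Pt (F.P K).d),
          -- MEETING DATUMS ONLY: the print box has a point within `3` of a lift of a site of `Ω_{K−n}`
          (∃ x ∈ box (F.P K).L (cornerP (F.P K) Mc ρ idx) (sideP (F.P K) Mc ρ) (K - n), ∃ y : Pt (F.P K).d, cover (F.P K) y ∈ s.Ω (K - n) ∧ Within ((3 : ℕ) : ℤ) x y) →
          -- PRINT-MARGIN-CLEAN DATUMS ONLY (print p. 300 + (144)'s margin cube «□̃» = the print box WIDENED BY `2ρ` BLOCKS): top level, or «□̃» misses `Ω_{j+1}`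
          (K - n = k ∨ ∀ z ∈ box (F.P K).L (cornerP (F.P K) Mc ρ idx - ((2 * ρ : ℕ) : Pt (F.P K).d)) (sideP (F.P K) Mc ρ + 2 * (2 * ρ)) (K - n),
            cover (F.P K) z ∉ s.Ω (K - n + 1)) →
          -- THE FAMILY: print's (150) `Ω′_j = □_j (j < k), Ω′_k = □_k ∩ Ω_k`
          ∀ {HVd : Domains (F.P K)}
            (_ : HVd = domainsMeet (cubeDomains (F.P K) (cornerP (F.P K) Mc ρ idx) (sideP (F.P K) Mc ρ) ρ (K - n) hk) (domainsOfSeq s.Ω (K - n) hk))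
            (lo hi : ℕ → Pt (F.P K).d),
          lo 0 = (fun i => ((F.P K).L : ℤ) * (sqLo (F.P K).L (cornerP (F.P K) Mc ρ idx) ρ (K - n) 1 i - 1)) →
          hi 0 = (fun i => ((F.P K).L : ℤ) * (sqHi (F.P K).L (cornerP (F.P K) Mc ρ idx) (sideP (F.P K) Mc ρ) ρ (K - n) 1 i + 1) + (((F.P K).L : ℤ) - 1)) →
          (∀ j', 1 ≤ j' → lo j' = sqLo (F.P K).L (cornerP (F.P K) Mc ρ idx) ρ (K - n) j' - 1) →
          (∀ j', 1 ≤ j' → hi j' = sqHi (F.P K).L (cornerP (F.P K) Mc ρ idx) (sideP (F.P K) Mc ρ) ρ (K - n) j' + 1) →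
          ∀ (u : GaugeTransf (F.P K) 0 (SU N)) (A : PBond (F.P K) 0 → MatA N),
          (∀ b ∈ (Sect2.regionOfSet (F.P K) (cover (F.P K) '' box (F.P K).L (cornerP (F.P K) Mc ρ idx) (sideP (F.P K) Mc ρ) (K - n))).bonds,
            gaugeU (fun x => ιSU N (u x)) (fun b' => ιSU N (U b')) b = expI ((F.P K).eta (K - n)) (A b)) →
          -- (T1) the gauge equation on the WHOLE TOWER `□₀` of the datum
          (∀ b ∈ (Sect2.regionOfSet (F.P K) (cover (F.P K) '' cube (F.P K).L (cornerP (F.P K) Mc ρ idx) (sideP (F.P K) Mc ρ) ρ (K - n) 0)).bonds,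
            gaugeU (fun x => ιSU N (u x)) (fun b' => ιSU N (U b')) b = expI ((F.P K).eta (K - n)) (A b)) →
          -- (T2) (152)'s LEVEL-WEIGHTED letters on every `□_{j′}`, `j′ ≤ K − n`
          (∀ j', j' ≤ K - n →
            ∀ b ∈ (Sect2.regionOfSet (F.P K) (cover (F.P K) '' cube (F.P K).L (cornerP (F.P K) Mc ρ idx) (sideP (F.P K) Mc ρ) ρ (K - n) j')).bonds,
              ‖A b‖ < κ * ε (K - n) * ((F.P K).L : ℝ) ^ (K - n - j')) →
          (∀ b ∈ (Sect2.regionOfSet (F.P K) (cover (F.P K) '' box (F.P K).L (cornerP (F.P K) Mc ρ idx) (sideP (F.P K) Mc ρ) (K - n))).bonds,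
            ‖A b‖ < κ * ε (K - n)) →
          (∀ q ∈ (Sect2.regionOfSet (F.P K) (cover (F.P K) '' box (F.P K).L (cornerP (F.P K) Mc ρ idx) (sideP (F.P K) Mc ρ) (K - n))).dpairs,
            ‖grad ((F.P K).eta (K - n)) q.2.1 (fun y => A ⟨y, q.2.2⟩) q.1‖ < κ * ε (K - n)) →
          (∀ b ∈ Sect2.bondsDeep (cover (F.P K) '' box (F.P K).L (cornerP (F.P K) Mc ρ idx) (sideP (F.P K) Mc ρ) (K - n)),
            ‖Sect2.codiffCurlA ((F.P K).eta (K - n)) A b.src b.dir‖ < κ * ε (K - n)) →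
          (∀ b ∈ Sect2.bondsDeep (cover (F.P K) '' box (F.P K).L (cornerP (F.P K) Mc ρ idx) (sideP (F.P K) Mc ρ) (K - n)),
            ‖∑ ν' : Fin (F.P K).d, (((F.P K).eta (K - n) : ℝ) : ℂ)⁻¹ •
                (grad ((F.P K).eta (K - n)) ν' (fun y => A ⟨y, b.dir⟩) (b.src.unshift ν') - grad ((F.P K).eta (K - n)) ν' (fun y => A ⟨y, b.dir⟩) b.src)‖ <
              κ * ε (K - n)) →
          (∀ D' : Domains (F.P K), LinearMap.ker (QpE D') ≤ LinearMap.ker (QpE HVd) → ∀ φ : MatA N →L[ℂ] ℂ,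
            RE D' ((F.P K).eta (K - n))⁻¹ (dsE ((F.P K).eta (K - n))⁻¹ (WithLp.toLp 2 fun b => (φ (A b)).re : BondSpace (F.P K))) = 0 ∧
            RE D' ((F.P K).eta (K - n))⁻¹ (dsE ((F.P K).eta (K - n))⁻¹ (WithLp.toLp 2 fun b => (φ (A b)).im : BondSpace (F.P K))) = 0) →
          -- ★ THE NORMALISATION of this `u` (print's «ū_j = 1 on Λ′_j»), as delivered by HS3NORM
          NrmOfRecordWide F N Mc ρ ν M g K k s U (K - n) idx u A →
          ∀ c : BondIdx HVd, ((c.1.1 : ℕ) = K - n ∨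
              (blockOf c.1.2.src ∈ (cubeDomains (F.P K) (cornerP (F.P K) Mc ρ idx) (sideP (F.P K) Mc ρ) ρ (K - n) hk).Om ((c.1.1 : ℕ) + 1) ∧
                blockOf c.1.2.tgt ∈ (cubeDomains (F.P K) (cornerP (F.P K) Mc ρ idx) (sideP (F.P K) Mc ρ) ρ (K - n) hk).Om ((c.1.1 : ℕ) + 1))) →
            ‖bondAvgIter (c.1.1 : ℕ) A c.1.2‖ ≤ β₁ ε δ (K - n))
      -- ★ (d′) THE (158) LETTERS of `A₁ = A − H_V(𝟙_reach·QA)` — displayed, NOT discharged (k0-s1 S4's line, at MODULE 76's pinned-local `H_V`)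
      (hA1 :
        ∀ (ν : Stage7Numerics) (M : ℕ) (g : ℕ → ℝ) (K k : ℕ) (s : SeqOfRecord F ν M g K k), Sect2.SeqSeparated ν.M₁ s → 0 < ν.M₁ →
          Adm ν M g K k s → 1 ≤ k →
          ∀ (ε δ : ℕ → ℝ),
          (∀ n, n ≤ k → 0 < δ n ∧ δ n ≤ a₁) → (∀ n, n < k → δ n ≤ 2 * δ (n + 1)) → (∀ n, n < k → δ (n + 1) ≤ 2 * δ n) →
          (∀ n, n ≤ k → B₃ * δ n ≤ ε n ∧ ε n ≤ a₀) → (∀ n, n < k → ε n ≤ 2 * ε (n + 1)) → (∀ n, n < k → ε (n + 1) ≤ 2 * ε n) →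
          ∀ W : MSField (F.P K) (SU N), Sect2.DataSmall7PTop (avOfRecord F N K) s.Ω (suppDomOfRecord F ν K s.Ω) k δ W →
          ∀ U : GaugeField (F.P K) 0 (SU N),
          (∀ n, n ≤ k → PlaqSmallOn (Sect2.omegaPlaqsTop s.Ω (suppDomOfRecord F ν K s.Ω) n) (ε n * (F.P K).eta n ^ 2) U) →
          (∀ n, n ≤ k → Sect2.CoDivSmallOn (Sect2.omegaBondsTop s.Ω (suppDomOfRecord F ν K s.Ω) n) (ε n * (F.P K).eta n ^ 3) U) →
          AgreeOn (genSet s.Ω k) (avgFamily (avOfRecord F N K) U) W → IsCritOnFibre F N K (genSet s.Ω k) W U →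
          ∀ (n : ℕ) (hk : K - n ≤ (F.P K).m + (F.P K).K), 1 ≤ K - n → K - n ≤ k → ∀ (idx : Pt (F.P K).d),
          -- MEETING DATUMS ONLY: the print box has a point within `3` of a lift of a site of `Ω_{K−n}`
          (∃ x ∈ box (F.P K).L (cornerP (F.P K) Mc ρ idx) (sideP (F.P K) Mc ρ) (K - n), ∃ y : Pt (F.P K).d, cover (F.P K) y ∈ s.Ω (K - n) ∧ Within ((3 : ℕ) : ℤ) x y) →
          -- PRINT-MARGIN-CLEAN DATUMS ONLY (print p. 300 + (144)'s margin cube «□̃» = the print box WIDENED BY `2ρ` BLOCKS): top level, or «□̃» misses `Ω_{j+1}`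
          (K - n = k ∨ ∀ z ∈ box (F.P K).L (cornerP (F.P K) Mc ρ idx - ((2 * ρ : ℕ) : Pt (F.P K).d)) (sideP (F.P K) Mc ρ + 2 * (2 * ρ)) (K - n),
            cover (F.P K) z ∉ s.Ω (K - n + 1)) →
          -- THE FAMILY: print's (150) `Ω′_j = □_j (j < k), Ω′_k = □_k ∩ Ω_k`
          ∀ {HVd : Domains (F.P K)}
            (_ : HVd = domainsMeet (cubeDomains (F.P K) (cornerP (F.P K) Mc ρ idx) (sideP (F.P K) Mc ρ) ρ (K - n) hk) (domainsOfSeq s.Ω (K - n) hk))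
            (lo hi : ℕ → Pt (F.P K).d),
          lo 0 = (fun i => ((F.P K).L : ℤ) * (sqLo (F.P K).L (cornerP (F.P K) Mc ρ idx) ρ (K - n) 1 i - 1)) →
          hi 0 = (fun i => ((F.P K).L : ℤ) * (sqHi (F.P K).L (cornerP (F.P K) Mc ρ idx) (sideP (F.P K) Mc ρ) ρ (K - n) 1 i + 1) + (((F.P K).L : ℤ) - 1)) →
          (∀ j', 1 ≤ j' → lo j' = sqLo (F.P K).L (cornerP (F.P K) Mc ρ idx) ρ (K - n) j' - 1) →
          (∀ j', 1 ≤ j' → hi j' = sqHi (F.P K).L (cornerP (F.P K) Mc ρ idx) (sideP (F.P K) Mc ρ) ρ (K - n) j' + 1) →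
          ∀ (HV : (BondIdx HVd → MatA N) →ₗ[ℂ] (PBond (F.P K) 0 → MatA N)),
            (∀ (Bf : BondIdx HVd → MatA N) (b : PBond (F.P K) 0), HV Bf b = ∑ c, ((flatH (F.P K) (K - n) HVd (Pi.single c 1) b : ℝ) : ℂ) • Bf c) →
          ∀ (u : GaugeTransf (F.P K) 0 (SU N)) (A : PBond (F.P K) 0 → MatA N),
          (∀ b ∈ (Sect2.regionOfSet (F.P K) (cover (F.P K) '' box (F.P K).L (cornerP (F.P K) Mc ρ idx) (sideP (F.P K) Mc ρ) (K - n))).bonds,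
            gaugeU (fun x => ιSU N (u x)) (fun b' => ιSU N (U b')) b = expI ((F.P K).eta (K - n)) (A b)) →
          -- (T1) the gauge equation on the WHOLE TOWER `□₀` of the datum
          (∀ b ∈ (Sect2.regionOfSet (F.P K) (cover (F.P K) '' cube (F.P K).L (cornerP (F.P K) Mc ρ idx) (sideP (F.P K) Mc ρ) ρ (K - n) 0)).bonds,
            gaugeU (fun x => ιSU N (u x)) (fun b' => ιSU N (U b')) b = expI ((F.P K).eta (K - n)) (A b)) →
          -- (T2) (152)'s LEVEL-WEIGHTED letters on every `□_{j′}`, `j′ ≤ K − n`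
          (∀ j', j' ≤ K - n →
            ∀ b ∈ (Sect2.regionOfSet (F.P K) (cover (F.P K) '' cube (F.P K).L (cornerP (F.P K) Mc ρ idx) (sideP (F.P K) Mc ρ) ρ (K - n) j')).bonds,
              ‖A b‖ < κ * ε (K - n) * ((F.P K).L : ℝ) ^ (K - n - j')) →
          (∀ b ∈ (Sect2.regionOfSet (F.P K) (cover (F.P K) '' box (F.P K).L (cornerP (F.P K) Mc ρ idx) (sideP (F.P K) Mc ρ) (K - n))).bonds,
            ‖A b‖ < κ * ε (K - n)) →
          (∀ q ∈ (Sect2.regionOfSet (F.P K) (cover (F.P K) '' box (F.P K).L (cornerP (F.P K) Mc ρ idx) (sideP (F.P K) Mc ρ) (K - n))).dpairs,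
            ‖grad ((F.P K).eta (K - n)) q.2.1 (fun y => A ⟨y, q.2.2⟩) q.1‖ < κ * ε (K - n)) →
          (∀ b ∈ Sect2.bondsDeep (cover (F.P K) '' box (F.P K).L (cornerP (F.P K) Mc ρ idx) (sideP (F.P K) Mc ρ) (K - n)),
            ‖Sect2.codiffCurlA ((F.P K).eta (K - n)) A b.src b.dir‖ < κ * ε (K - n)) →
          (∀ b ∈ Sect2.bondsDeep (cover (F.P K) '' box (F.P K).L (cornerP (F.P K) Mc ρ idx) (sideP (F.P K) Mc ρ) (K - n)),
            ‖∑ ν' : Fin (F.P K).d, (((F.P K).eta (K - n) : ℝ) : ℂ)⁻¹ •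
                (grad ((F.P K).eta (K - n)) ν' (fun y => A ⟨y, b.dir⟩) (b.src.unshift ν') - grad ((F.P K).eta (K - n)) ν' (fun y => A ⟨y, b.dir⟩) b.src)‖ <
              κ * ε (K - n)) →
          (∀ D' : Domains (F.P K), LinearMap.ker (QpE D') ≤ LinearMap.ker (QpE HVd) → ∀ φ : MatA N →L[ℂ] ℂ,
            RE D' ((F.P K).eta (K - n))⁻¹ (dsE ((F.P K).eta (K - n))⁻¹ (WithLp.toLp 2 fun b => (φ (A b)).re : BondSpace (F.P K))) = 0 ∧
            RE D' ((F.P K).eta (K - n))⁻¹ (dsE ((F.P K).eta (K - n))⁻¹ (WithLp.toLp 2 fun b => (φ (A b)).im : BondSpace (F.P K))) = 0) →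
          -- ★ THE NORMALISATION of this `u` (print's «ū_j = 1 on Λ′_j»), as delivered by HS3NORM
          NrmOfRecordWide F N Mc ρ ν M g K k s U (K - n) idx u A →
          Letters10On (cover (F.P K) '' box (F.P K).L (cornerP (F.P K) Mc ρ idx) (sideP (F.P K) Mc ρ) (K - n)) ((F.P K).eta (K - n)) (t₁ ε δ (K - n))
            (fun b => A b - HV (fun c : BondIdx HVd =>
              if (∀ x : Site (F.P K) 0, (iterBlockOf (c.1.1 : ℕ) x = c.1.2.src ∨ iterBlockOf (c.1.1 : ℕ) x = c.1.2.tgt) →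
                  x ∈ cover (F.P K) '' cube (F.P K).L (cornerP (F.P K) Mc ρ idx) (sideP (F.P K) Mc ρ) ρ (K - n) 0)
              then bondAvgIter (c.1.1 : ℕ) A c.1.2 else 0) b)),
      Prop8RegSepTopStepG F N (fun ν K Ω => suppDomOfRecord F ν K Ω) Adm B₃ a₀ a₁ := by
  obtain ⟨Mh₀, R₀, CH, δH, BH, hCH, hδH, hBH, hmain⟩ := prop8RegSepTopStepG_of_normalisedGauge_of_chartMeetTowerW F N
  refine ⟨Mh₀, R₀, CH, δH, BH, hCH, hδH, hBH, ?_⟩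
  intro ρ Mc Mh R a' hMc hMcρ hMha hMh hR hdvd hRρ hLρ c c₀ hc hc₀ hmc₀ hac₀ Adm hAdm₁ hAdm₂ B₃ C θ Q κ a₀ a₁ hB₃ hC0 hθ0 hQ0 hκ
    hB₃L hC hθ ha hκa β₁ t₁ hβ₁ hbudget hT hQnear hA1
  -- the letters of record: `β₂ := κ·L·ε_j` (MODULE 78 ∕ 82b), `s′ := 0` (82a's `B′ := 0`), `θ_H := 8 C_H B_H e^{−δ_H ρ}` (77c's floor)
  have hletters : ∀ (ε δ : ℕ → ℝ) (j : ℕ), 0 < δ j → δ j ≤ a₁ → B₃ * δ j ≤ ε j → ε j ≤ a₀ →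
      0 ≤ β₁ ε δ j ∧ 0 ≤ (fun (ε : ℕ → ℝ) (_ : ℕ → ℝ) (j : ℕ) => κ * (F.L : ℝ) * ε j) ε δ j ∧
        0 ≤ (fun (_ : ℕ → ℝ) (_ : ℕ → ℝ) (_ : ℕ) => (0 : ℝ)) ε δ j := by
    intro ε δ j hδ hδa hBδ hεa
    have hεj : 0 ≤ ε j := by nlinarith
    exact ⟨hβ₁ ε δ j hδ hδa hBδ hεa, mul_nonneg (mul_nonneg hκ.le (Nat.cast_nonneg _)) hεj, le_rfl⟩
  have hbudget' : ∀ (K : ℕ) (ε δ : ℕ → ℝ) (j : ℕ), 0 < δ j → δ j ≤ a₁ → B₃ * δ j ≤ ε j → ε j ≤ a₀ → ∃ t₂ t₃ : ℝ,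
      1 / 4 * ((sideP (F.P K) Mc ρ : ℕ) : ℝ) *
          max (4 * CH * BH * β₁ ε δ j)
            (8 * CH * BH * Real.exp (-(δH * (ρ : ℝ))) * (fun (ε : ℕ → ℝ) (_ : ℕ → ℝ) (j : ℕ) => κ * (F.L : ℝ) * ε j) ε δ j) < t₂ ∧
        2 * CH * BH * (fun (_ : ℕ → ℝ) (_ : ℕ → ℝ) (_ : ℕ) => (0 : ℝ)) ε δ j < t₃ ∧
        t₁ ε δ j + t₂ + t₃ < C * δ j + θ * ε j + Q * ε j ^ 2 := by
    intro K ε δ j hδ hδa hBδ hεa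
    obtain ⟨t₂, t₃, ht₂, ht₃, hsum⟩ := exists_thresholds_of_budget_lt (hbudget K ε δ j hδ hδa hBδ hεa)
    exact ⟨t₂, t₃, ht₂, by simpa only [mul_zero] using ht₃, hsum⟩
  exact hmain hMc hMcρ hMha hMh hR hdvd hRρ hLρ hc hc₀ hmc₀ hac₀ Adm hAdm₁ hAdm₂ hB₃ hC0 hθ0 hQ0 hκ.le le_rfl hB₃L hC hθ ha hκa
    β₁ (fun (ε : ℕ → ℝ) (_ : ℕ → ℝ) (j : ℕ) => κ * (F.L : ℝ) * ε j) (fun (_ : ℕ → ℝ) (_ : ℕ → ℝ) (_ : ℕ) => (0 : ℝ)) t₁ hletters hbudget'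
    (NrmOfRecordWide F N Mc ρ) (hS3NORM67c_of_hThm4Rec F N hc hc₀ Adm hAdm₁ hB₃ hκ hT)
    (chartMeetNorm77_of_letters F N hLρ Adm hB₃ hκ.le β₁ (fun (ε : ℕ → ℝ) (_ : ℕ → ℝ) (j : ℕ) => κ * (F.L : ℝ) * ε j)
      (fun (_ : ℕ → ℝ) (_ : ℕ → ℝ) (_ : ℕ) => (0 : ℝ)) t₁ rfl (fun _ _ _ => le_rfl) hQnear hA1)

end Summit.QuantumFields.YangMills.BalabanUVNodes.N07Prop8StepTokenOfRecordOfLetters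

end
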